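import Summits.CriticalPhenomena.PercolationContinuityZ3.Theorems.PercNearOneGluingNoHeavyQuantBlockCombTwoPlateauRoot
import HarnessLib

/-!
# QUANT lane R8, FAR on trees: every block-comb that is ALL-TIED EXCEPT ONE BLOCK (canonical model, every depth)

builds on p205010 (kernel theorem, internal audit signed; external expert review pending)

Support file (`--supports stmt-CriticalPhenomena-4575`), QUANT lane lead (gen 13); memo `run/shared/lean/prim/quant/prim-quant-lead-g13/LEAD-NOTES-G13.md`
N24 (8).  Theorems only, no sorries, standard axioms.  Model/notation: `…QuantBlockCombMergeModel.lean`; tools: p1 g8's law-free MERGE step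
`tail_transfer_le` and `tail_ge_marg_of_giant`, the CLASS theorem `tail_ge_of_class` (lead g12), lead g13's ROOT CONTRACTION `tail_contract_root`,
tied theorem `tail_ge_of_commonRoot_tied` (`…RootContraction`) and `sum_marg_le_contracted` (`…TwoPlateauRoot`).
* `Quant.BlockComb.tail_ge_of_tied_plus_one` (root form `tail_ge_of_tied_plus_root`) — **THEOREM.**  Chain of `D+1` gates; a designated blob `s₀`
  (the budget carrier: ANY level, ANY gate, marginal `≥ x`, possibly dead); every OTHER live blob TIED at `x = ∏_{i ≤ D} q i > 0`; budget
  `2j < Σ_k a k·marginal k` (`= EN`).  Then `x ≤ TAIL = P(N ≥ j+1)`: EVERY block-comb that is all-tied except ONE block satisfies the far-relay row —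
  the budget-binding family '(tied root blocks) + (one carrier) + (tied staircase)' that the normal form of N24 (1)/(4) pushes a minimal counterexample to.
  PROOF (induction on `#live blobs + D`): giant; else a live tied ROOT blob `τ ≠ s₀` is merged by `tail_transfer_le` — `j ≤ x·(n − a τ)` is FORCED,
  since otherwise `x·n < j(1+x)` and the budget gives `a s₀·(marginal s₀ − x) > j(1 − x)`, a giant — keeping the family and not lowering `EN`; with no
  tied root blob left: all live blobs tied (`tail_ge_of_class`), or `s₀` at the root with `g s₀·q 0 ≤ x` (`tail_ge_of_commonRoot_tied`), or else `D ≥ 1`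
  and ROOT CONTRACTION gives the same family one level down at `x/q 0` with a mean at least as large.
Honest scope: two or more NON-tied blocks are not covered (N24 (9): scheme + one corner).
-/

namespace Summit.CriticalPhenomena.PercolationContinuityZ3.Theorems

namespace Quant

namespace BlockComb

open Finset

variable {κ : Type*} [Fintype κ] [DecidableEq κ]

/-- product-Bernoulli weight of the set `S` of open blob gates -/
local notation3 "wt[" g ", " S "]" => ∏ k, (if k ∈ (S : Finset κ) then (g : κ → ℝ) k else 1 - (g : κ → ℝ) k)

/-- probability that the chain `q` of length `D` is open exactly to depth `i` -/
local notation3 "pd[" D ", " q ", " i "]" =>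
  (∏ i' ∈ Finset.range (i : ℕ), (q : ℕ → ℝ) i') * (if (i : ℕ) < (D : ℕ) then 1 - (q : ℕ → ℝ) i else 1)

/-- mass counted at depth `i` in blob configuration `S` -/
local notation3 "mass[" lv ", " a ", " i ", " S "]" =>
  ∑ k ∈ (S : Finset κ).filter (fun k => (lv : κ → ℕ) k ≤ (i : ℕ)), ((a : κ → ℕ) k : ℕ)

/-- the tail `P(N ≥ j+1)` of the block-comb count, as an explicit finite sum -/
local notation3 "TAIL[" D ", " q ", " lv ", " a ", " g ", " j "]" =>
  ∑ i ∈ Finset.range ((D : ℕ) + 1), pd[D, q, i] *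
    ∑ S : Finset κ, wt[g, S] * (if (j : ℕ) + 1 ≤ mass[lv, a, i, S] then (1 : ℝ) else 0)

/-! ### 1. Bookkeeping -/

omit [Fintype κ] in
/-- Updating one size updates the weighted size function. [folklore] -/
theorem cast_update_mul (a : κ → ℕ) (m : κ → ℝ) (s : κ) (v : ℕ) (k : κ) :
    ((Function.update a s v k : ℕ) : ℝ) * m k = Function.update (fun k => (a k : ℝ) * m k) s ((v : ℝ) * m s) k := by
  by_cases hk : k = s
  · subst hk; simp
  · rw [Function.update_of_ne hk, Function.update_of_ne hk]

/-- Sum of an updated function over the whole type. [folklore] -/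
theorem sum_update_univ (f : κ → ℝ) (s : κ) (b : ℝ) :
    ∑ k, Function.update f s b k = ∑ k, f k - f s + b := by
  rw [Finset.sum_update_of_mem (Finset.mem_univ s),
    Finset.sum_eq_add_sum_sdiff_singleton_of_mem (Finset.mem_univ s) f]
  ring

/-- The weighted size after a transfer `a ↦ a[τ ↦ 0][ℓ ↦ a ℓ + a τ]` (`ℓ ≠ τ`): the mean changes by `a τ·(m ℓ − m τ)`. [folklore] -/
theorem sum_cast_mul_transfer (a : κ → ℕ) (m : κ → ℝ) (τ ℓ : κ) (hℓτ : ℓ ≠ τ) :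
    ∑ k, ((Function.update (Function.update a τ 0) ℓ (Function.update a τ 0 ℓ + a τ) k : ℕ) : ℝ) * m k =
      ∑ k, (a k : ℝ) * m k + (a τ : ℝ) * (m ℓ - m τ) := by
  have h1 : ∀ k, ((Function.update (Function.update a τ 0) ℓ (Function.update a τ 0 ℓ + a τ) k : ℕ) : ℝ) * m k =
      Function.update (fun k => ((Function.update a τ 0 k : ℕ) : ℝ) * m k) ℓ
        (((Function.update a τ 0 ℓ + a τ : ℕ) : ℝ) * m ℓ) k := fun k => cast_update_mul _ m ℓ _ k
  have h2 : ∀ k, ((Function.update a τ 0 k : ℕ) : ℝ) * m k =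
      Function.update (fun k => (a k : ℝ) * m k) τ (((0 : ℕ) : ℝ) * m τ) k := fun k => cast_update_mul a m τ 0 k
  rw [Finset.sum_congr rfl fun k _ => h1 k, sum_update_univ, Finset.sum_congr rfl fun k _ => h2 k, sum_update_univ,
    Function.update_of_ne hℓτ]
  push_cast
  ring

/-- The live set after a transfer loses exactly the emptied blob. [folklore] -/
theorem card_live_transfer (a : κ → ℕ) (τ ℓ : κ) (hℓτ : ℓ ≠ τ) (hτ : 0 < a τ) (hℓ : 0 < a ℓ) :
    (Finset.univ.filter (fun k => 0 < Function.update (Function.update a τ 0) ℓ (Function.update a τ 0 ℓ + a τ) k)).card + 1 =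
      (Finset.univ.filter (fun k => 0 < a k)).card := by
  have hset : Finset.univ.filter (fun k => 0 < Function.update (Function.update a τ 0) ℓ (Function.update a τ 0 ℓ + a τ) k) =
      (Finset.univ.filter (fun k => 0 < a k)).erase τ := by
    ext k
    simp only [Finset.mem_filter, Finset.mem_univ, true_and, Finset.mem_erase]
    by_cases hkℓ : k = ℓ
    · subst hkℓ
      rw [Function.update_self, Function.update_of_ne hℓτ]
      exact ⟨fun _ => ⟨hℓτ, hℓ⟩, fun _ => by omega⟩
    · rw [Function.update_of_ne hkℓ]
      by_cases hkτ : k = τ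
      · subst hkτ
        rw [Function.update_self]
        exact ⟨fun h => absurd h (lt_irrefl 0), fun h => absurd rfl h.1⟩
      · rw [Function.update_of_ne hkτ]
        exact ⟨fun h => ⟨hkτ, h⟩, fun h => h.2⟩
  have hτmem : τ ∈ Finset.univ.filter (fun k => 0 < a k) := Finset.mem_filter.2 ⟨Finset.mem_univ _, hτ⟩
  rw [hset, Finset.card_erase_of_mem hτmem]
  have hpos : 0 < (Finset.univ.filter (fun k => 0 < a k)).card := Finset.card_pos.2 ⟨τ, hτmem⟩
  omega

/-! ### 2. The theorem -/

/-- The induction behind `tail_ge_of_tied_plus_one` (on `#live blobs + D`). [this work] -/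
theorem tail_ge_of_tied_plus_one_aux : ∀ (M : ℕ) (D : ℕ) (q : ℕ → ℝ), (∀ i, 0 ≤ q i ∧ q i ≤ 1) →
    ∀ (lv : κ → ℕ) (a : κ → ℕ) (g : κ → ℝ), (∀ k, 0 ≤ g k ∧ g k ≤ 1) → ∀ (j : ℕ),
    (∀ k, 0 < a k → lv k ≤ D + 1) →
    ∀ (s₀ : κ) (x : ℝ), 0 < x → x = ∏ i ∈ Finset.range (D + 1), q i →
    (∀ k, 0 < a k → k ≠ s₀ → (∏ i ∈ Finset.range (lv k), q i) * g k = x) →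
    x ≤ (∏ i ∈ Finset.range (lv s₀), q i) * g s₀ →
    (2 * j : ℝ) < ∑ k, (a k : ℝ) * ((∏ i ∈ Finset.range (lv k), q i) * g k) →
    (Finset.univ.filter (fun k => 0 < a k)).card + D ≤ M →
    x ≤ TAIL[D + 1, q, lv, a, g, j] := by
  intro M
  induction M with
  | zero =>
    intro D q hq lv a g hg j hlv s₀ x hx0 hxq htied hheavy hbudget hM
    -- no live blob: the budget `0 > 2j ≥ 0` is absurd
    have hcard : (Finset.univ.filter (fun k => 0 < a k)).card = 0 := by omega
    have hnone : ∀ k, a k = 0 := by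
      intro k
      by_contra hk
      have : k ∈ Finset.univ.filter (fun k => 0 < a k) := Finset.mem_filter.2 ⟨Finset.mem_univ _, Nat.pos_of_ne_zero hk⟩
      rw [Finset.card_eq_zero.1 hcard] at this
      exact absurd this (Finset.notMem_empty _)
    have h0 : ∑ k, (a k : ℝ) * ((∏ i ∈ Finset.range (lv k), q i) * g k) = 0 :=
      Finset.sum_eq_zero fun k _ => by rw [hnone k]; simp
    have : (0 : ℝ) ≤ 2 * j := by positivity
    linarith
  | succ M ih =>
    intro D q hq lv a g hg j hlv s₀ x hx0 hxq htied hheavy hbudget hM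
    -- the marginal of the designated block and of every live blob
    set ρ : ℝ := (∏ i ∈ Finset.range (lv s₀), q i) * g s₀ with hρdef
    have hρ1 : ρ ≤ 1 := mul_le_one₀ (prefixProd_mem q hq _).2 (hg s₀).1 (hg s₀).2
    have hmarg : ∀ k, 0 < a k → x ≤ (∏ i ∈ Finset.range (lv k), q i) * g k := by
      intro k hk
      by_cases hks : k = s₀
      · rw [hks]; exact hheavy
      · exact (htied k hk hks).ge
    by_cases hgiant : ∃ k, 0 < a k ∧ j + 1 ≤ a k
    · obtain ⟨k, hk, hkj⟩ := hgiant
      exact (hmarg k hk).trans (tail_ge_marg_of_giant (D + 1) q hq lv a g hg j k hkj (hlv k hk))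
    push Not at hgiant
    have hsmall : ∀ k, (a k : ℝ) ≤ j := by
      intro k
      by_cases hk : 0 < a k
      · exact_mod_cast Nat.lt_succ_iff.1 (hgiant k hk)
      · have : a k = 0 := by omega
        rw [this]; exact_mod_cast Nat.zero_le j
    set n : ℝ := ∑ k, (a k : ℝ) with hn
    have hmean_eq : ∑ k, (a k : ℝ) * ((∏ i ∈ Finset.range (lv k), q i) * g k) = x * n + (a s₀ : ℝ) * (ρ - x) := by
      rw [hn, Finset.mul_sum, Finset.sum_eq_add_sum_sdiff_singleton_of_mem (Finset.mem_univ s₀),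
        Finset.sum_eq_add_sum_sdiff_singleton_of_mem (Finset.mem_univ s₀) (fun k => x * (a k : ℝ))]
      have hrest : ∑ k ∈ Finset.univ \ {s₀}, (a k : ℝ) * ((∏ i ∈ Finset.range (lv k), q i) * g k) =
          ∑ k ∈ Finset.univ \ {s₀}, x * (a k : ℝ) := by
        refine Finset.sum_congr rfl fun k hk => ?_
        have hks : k ≠ s₀ := fun h => by rw [Finset.mem_sdiff, Finset.mem_singleton] at hk; exact hk.2 h
        by_cases hak : 0 < a k
        · rw [htied k hak hks]; ring
        · have : a k = 0 := by omega
          rw [this]; simp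
      rw [hrest, hρdef]; ring
    -- (ii) a live tied ROOT blob other than `s₀`: merge it
    by_cases htroot : ∃ τ, 0 < a τ ∧ τ ≠ s₀ ∧ lv τ = 0
    · obtain ⟨τ, hτ, hτs, hτ0⟩ := htroot
      have hgτ : g τ = x := by have := htied τ hτ hτs; rwa [hτ0, Finset.prod_range_zero, one_mul] at this
      set a₀ := Function.update a τ 0 with ha₀
      have ha₀τ : a₀ τ = 0 := by rw [ha₀, Function.update_self]
      have ha₀ne : ∀ k, k ≠ τ → a₀ k = a k := fun k hk => by rw [ha₀, Function.update_of_ne hk]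
      have hsum₀ : ∑ k, ((a₀ k : ℕ) : ℝ) = n - a τ := by
        have h := sum_update_univ (fun k => (a k : ℝ)) τ ((0 : ℕ) : ℝ)
        have h' : ∀ k, ((a₀ k : ℕ) : ℝ) = Function.update (fun k => (a k : ℝ)) τ ((0 : ℕ) : ℝ) k := by
          intro k
          by_cases hk : k = τ
          · subst hk; simp [ha₀τ]
          · rw [ha₀ne k hk, Function.update_of_ne hk]
        rw [Finset.sum_congr rfl fun k _ => h' k, h, hn]
        push_cast; ring
      -- the merge hypothesis `j ≤ x·(n − a τ)`: otherwise `s₀` would be a giant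
      have hM' : (j : ℝ) ≤ g τ * ∑ k, ((a₀ k : ℕ) : ℝ) := by
        rw [hgτ, hsum₀]
        by_contra hlt
        push Not at hlt
        have h1 : x * n + (a s₀ : ℝ) * (ρ - x) > 2 * j := by rw [← hmean_eq]; exact hbudget
        have h2 : (a τ : ℝ) ≤ j := hsmall τ
        have h3 : (a s₀ : ℝ) ≤ j := hsmall s₀
        have h5 : (0 : ℝ) ≤ a s₀ := Nat.cast_nonneg _
        nlinarith [mul_le_mul_of_nonneg_left hρ1 h5, hx0.le]
      have hpos : ∃ k, 0 < a₀ k := by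
        -- some other blob is live: else the mean is `x·a τ ≤ j ≤ 2j`
        by_contra hnone
        push Not at hnone
        have hzero : ∀ k, k ≠ τ → a k = 0 := fun k hk => by have := hnone k; rw [ha₀ne k hk] at this; omega
        have hnτ : n = a τ := by
          rw [hn, Finset.sum_eq_add_sum_sdiff_singleton_of_mem (Finset.mem_univ τ) (fun k => (a k : ℝ))]
          rw [Finset.sum_eq_zero fun k hk => by
            have hkτ : k ≠ τ := fun h => by rw [Finset.mem_sdiff, Finset.mem_singleton] at hk; exact hk.2 h
            rw [hzero k hkτ]; simp]
          ring
        have h1 : x * n + (a s₀ : ℝ) * (ρ - x) > 2 * j := by rw [← hmean_eq]; exact hbudget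
        rw [hzero s₀ hτs.symm, hnτ] at h1
        push_cast at h1
        have h2 : (a τ : ℝ) ≤ j := hsmall τ
        have hx1 : x ≤ 1 := hheavy.trans hρ1
        have h5 : (0 : ℝ) ≤ a τ := Nat.cast_nonneg _
        have h6 : x * (a τ : ℝ) ≤ 1 * (a τ : ℝ) := mul_le_mul_of_nonneg_right hx1 h5
        have : (0:ℝ) ≤ j := Nat.cast_nonneg _
        linarith
      obtain ⟨ℓ, hℓ, hle⟩ := tail_transfer_le (D + 1) q hq lv a g hg j τ hτ0 hM' hpos
      have hℓτ : ℓ ≠ τ := by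
        rintro rfl
        rw [Function.update_self] at hℓ
        exact lt_irrefl _ hℓ
      have haℓ : 0 < a ℓ := by
        have h := hℓ
        rwa [Function.update_of_ne hℓτ] at h
      set aT := Function.update a₀ ℓ (a₀ ℓ + a τ) with haT
      have haTτ : aT τ = 0 := by rw [haT, Function.update_of_ne hℓτ.symm, ha₀τ]
      have haTne : ∀ k, k ≠ τ → k ≠ ℓ → aT k = a k := fun k hkτ hkℓ => by
        rw [haT, Function.update_of_ne hkℓ, ha₀ne k hkτ]
      have hlive : ∀ k, 0 < aT k → 0 < a k ∧ k ≠ τ := by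
        intro k hk
        have hkτ : k ≠ τ := fun h => by rw [h, haTτ] at hk; exact lt_irrefl _ hk
        refine ⟨?_, hkτ⟩
        by_cases hkℓ : k = ℓ
        · rw [hkℓ]; exact haℓ
        · rw [← haTne k hkτ hkℓ]; exact hk
      have hlvT : ∀ k, 0 < aT k → lv k ≤ D + 1 := fun k hk => hlv k (hlive k hk).1
      have htiedT : ∀ k, 0 < aT k → k ≠ s₀ → (∏ i ∈ Finset.range (lv k), q i) * g k = x :=
        fun k hk hks => htied k (hlive k hk).1 hks
      have hbudgetT : (2 * j : ℝ) < ∑ k, (aT k : ℝ) * ((∏ i ∈ Finset.range (lv k), q i) * g k) := by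
        have h := sum_cast_mul_transfer a (fun k => (∏ i ∈ Finset.range (lv k), q i) * g k) τ ℓ hℓτ
        rw [haT, ha₀, h]
        have hmτ : (∏ i ∈ Finset.range (lv τ), q i) * g τ = x := htied τ hτ hτs
        have hmℓ : x ≤ (∏ i ∈ Finset.range (lv ℓ), q i) * g ℓ := hmarg ℓ haℓ
        have h5 : (0 : ℝ) ≤ a τ := Nat.cast_nonneg _
        nlinarith [mul_le_mul_of_nonneg_left hmℓ h5]
      have hcardT : (Finset.univ.filter (fun k => 0 < aT k)).card + 1 = (Finset.univ.filter (fun k => 0 < a k)).card := by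
        rw [haT, ha₀]; exact card_live_transfer a τ ℓ hℓτ hτ haℓ
      have hMT : (Finset.univ.filter (fun k => 0 < aT k)).card + D ≤ M := by omega
      exact (ih D q hq lv aT g hg j hlvT s₀ x hx0 hxq htiedT hheavy hbudgetT hMT).trans hle
    -- (iii) no live tied root blob other than `s₀`
    push Not at htroot
    have hrootonly : ∀ k, 0 < a k → lv k = 0 → k = s₀ := fun k hk hk0 => by
      by_contra hks; exact htroot k hk hks hk0
    have hne : ∃ k, 0 < a k := by
      by_contra hnone
      push Not at hnone
      have h0 : ∑ k, (a k : ℝ) * ((∏ i ∈ Finset.range (lv k), q i) * g k) = 0 := by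
        refine Finset.sum_eq_zero fun k _ => ?_
        have hk : a k = 0 := by have := hnone k; omega
        rw [hk]; simp
      have : (0 : ℝ) ≤ 2 * j := by positivity
      linarith
    by_cases hall : a s₀ = 0 ∨ ρ = x
    · -- every live blob is tied: the class theorem at `x`
      have hclass : (2 * j : ℝ) < (∑ k', (a k' : ℝ)) * x := by
        have : (a s₀ : ℝ) * (ρ - x) = 0 := by
          rcases hall with h | h
          · rw [h]; simp
          · rw [h]; ring
        rw [hmean_eq, this, add_zero] at hbudget
        have h' : x * n = (∑ k', (a k' : ℝ)) * x := by rw [hn]; ring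
        linarith
      exact tail_ge_of_class (D + 1) q hq lv a g hg j hlv x hmarg hclass hne
    push Not at hall
    have hs₀live : 0 < a s₀ := Nat.pos_of_ne_zero hall.1
    have hρx : x < ρ := lt_of_le_of_ne hheavy (Ne.symm hall.2)
    have hq0 : 0 < q 0 := by
      rcases (hq 0).1.lt_or_eq with h | h
      · exact h
      · exfalso; rw [hxq, prefixProd_succ, ← h, zero_mul] at hx0; exact lt_irrefl _ hx0
    -- the contracted instance (used when `s₀` is deep, or at the root in the regime `x < ρ·q 0`)
    have hcontract : ∀ D', D = D' + 1 → (∑ k ∈ Finset.univ.filter (fun k => lv k = 0), a k ≤ j) →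
        x / q 0 ≤ (∏ i ∈ Finset.range (lv s₀ - 1), q (i + 1)) * g s₀ →
        x ≤ TAIL[D + 1, q, lv, a, g, j] := by
      rintro D' rfl hroot hheavy'
      rw [tail_contract_root (D' + 1) q lv a g j hroot]
      have hx' : x / q 0 = ∏ i ∈ Finset.range (D' + 1), q (i + 1) := by
        rw [div_eq_iff hq0.ne', hxq, prefixProd_succ, mul_comm]
      have htied' : ∀ k, 0 < a k → k ≠ s₀ → (∏ i ∈ Finset.range (lv k - 1), q (i + 1)) * g k = x / q 0 := by
        intro k hk hks
        have hk0 : lv k ≠ 0 := fun h => hks (hrootonly k hk h)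
        obtain ⟨m, hm⟩ := Nat.exists_eq_succ_of_ne_zero hk0
        have h := htied k hk hks
        rw [hm, prefixProd_succ] at h
        rw [hm, Nat.succ_sub_one, eq_div_iff hq0.ne']
        linarith [h]
      have hlv' : ∀ k, 0 < a k → lv k - 1 ≤ D' + 1 := fun k hk => by have := hlv k hk; omega
      have hbudget' : (2 * j : ℝ) < ∑ k, (a k : ℝ) * ((∏ i ∈ Finset.range (lv k - 1), q (i + 1)) * g k) :=
        hbudget.trans_le (sum_marg_le_contracted q hq lv a g hg)
      have hM' : (Finset.univ.filter (fun k => 0 < a k)).card + D' ≤ M := by omega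
      have h := ih D' (fun i => q (i + 1)) (fun i => hq (i + 1)) (fun k => lv k - 1) a g hg j hlv' s₀
        (x / q 0) (div_pos hx0 hq0) hx' htied' hheavy' hbudget' hM'
      calc x = q 0 * (x / q 0) := by field_simp
        _ ≤ q 0 * TAIL[D' + 1, (fun i => q (i + 1)), (fun k => lv k - 1), a, g, j] := mul_le_mul_of_nonneg_left h (hq 0).1
    by_cases hl0 : lv s₀ = 0
    · -- the heavy block sits at the root: `ρ = g s₀`
      have hρg : ρ = g s₀ := by rw [hρdef, hl0, Finset.prod_range_zero, one_mul]
      -- the root mass is `a s₀ ≤ j`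
      have hroot : ∑ k ∈ Finset.univ.filter (fun k => lv k = 0), a k ≤ j := by
        have : ∑ k ∈ Finset.univ.filter (fun k => lv k = 0), a k = a s₀ := by
          rw [Finset.sum_eq_single_of_mem s₀ (Finset.mem_filter.2 ⟨Finset.mem_univ _, hl0⟩)]
          intro k hk hks
          have hk0 : lv k = 0 := (Finset.mem_filter.1 hk).2
          by_contra hak
          exact hks (hrootonly k (Nat.pos_of_ne_zero hak) hk0)
        rw [this]
        exact Nat.lt_succ_iff.1 (hgiant s₀ hs₀live)
      by_cases hreg : g s₀ * q 0 ≤ x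
      · -- regime `ρ·q 0 ≤ x`: the tied theorem
        refine tail_ge_of_commonRoot_tied (κ := κ) D q hq lv a g hg j hlv (g s₀) x (hg s₀).2 hx0 ?_ hroot ?_ hreg ?_
        · intro k hk hk0; rw [hrootonly k hk hk0]
        · intro k hk hk0
          exact htied k hk (fun h => hk0 (by rw [h, hl0]))
        · -- `2j < (Σ a)·ρ` since every live marginal is `≤ ρ`
          refine hbudget.trans_le ?_
          rw [Finset.sum_mul]
          refine Finset.sum_le_sum fun k _ => ?_
          by_cases hak : 0 < a k
          · refine mul_le_mul_of_nonneg_left ?_ (Nat.cast_nonneg _)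
            by_cases hks : k = s₀
            · rw [hks, hl0, Finset.prod_range_zero, one_mul]
            · rw [htied k hak hks, ← hρg]; exact hρx.le
          · have : a k = 0 := by omega
            rw [this]; simp
      · -- regime `x < ρ·q 0`: contract; `D ≥ 1` since at `D = 0`, `x = q 0 ≥ ρ·q 0`
        push Not at hreg
        obtain ⟨D', hD⟩ : ∃ D', D = D' + 1 := by
          cases D with
          | zero =>
            exfalso
            rw [Finset.prod_range_one] at hxq
            have : g s₀ * q 0 ≤ q 0 := mul_le_of_le_one_left (hq 0).1 (hg s₀).2
            rw [hxq] at hreg; linarith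
          | succ D' => exact ⟨D', rfl⟩
        refine hcontract D' hD hroot ?_
        rw [hl0, Nat.zero_sub, Finset.prod_range_zero, one_mul, div_le_iff₀ hq0]
        exact hreg.le
    · -- the heavy block is deeper: no live root blob at all; contract one level
      have hroot : ∑ k ∈ Finset.univ.filter (fun k => lv k = 0), a k ≤ j := by
        rw [Finset.sum_eq_zero fun k hk => ?_]
        · exact Nat.zero_le j
        · have hk0 : lv k = 0 := (Finset.mem_filter.1 hk).2
          by_contra hak
          have := hrootonly k (Nat.pos_of_ne_zero hak) hk0
          exact hl0 (this ▸ hk0)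
      obtain ⟨m, hm⟩ := Nat.exists_eq_succ_of_ne_zero hl0
      -- `D ≥ 1`: at `D = 0` the block `s₀` would sit at level `1` with marginal `q 0·g s₀ ≤ q 0 = x`
      obtain ⟨D', hD⟩ : ∃ D', D = D' + 1 := by
        cases D with
        | zero =>
          exfalso
          have h1 : lv s₀ ≤ 1 := hlv s₀ hs₀live
          have hm1 : m = 0 := by omega
          rw [Finset.prod_range_one] at hxq
          have : ρ ≤ q 0 := by
            rw [hρdef, hm, hm1, Finset.prod_range_one]
            exact mul_le_of_le_one_right (hq 0).1 (hg s₀).2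
          rw [hxq] at hρx; linarith
        | succ D' => exact ⟨D', rfl⟩
      refine hcontract D' hD hroot ?_
      have h := hρx.le
      rw [hρdef, hm, prefixProd_succ] at h
      rw [hm, Nat.succ_sub_one, div_le_iff₀ hq0]
      linarith [h]

/-- **THEOREM (FAR for every block-comb that is all-tied except one block, canonical model, every depth).**  Chain gates and private
gates in `[0,1]`; live levels `≤ D+1`; a designated blob `s₀` (any level, any gate, possibly dead) with marginal `≥ x`; every other live
blob with marginal exactly `x = ∏_{i ≤ D} q i > 0`; `2j < Σ_k a k·marginal k`.  Conclusion: `x ≤ P(N ≥ j+1)`. [this work] -/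
theorem tail_ge_of_tied_plus_one (D : ℕ) (q : ℕ → ℝ) (hq : ∀ i, 0 ≤ q i ∧ q i ≤ 1) (lv : κ → ℕ) (a : κ → ℕ)
    (g : κ → ℝ) (hg : ∀ k, 0 ≤ g k ∧ g k ≤ 1) (j : ℕ) (hlv : ∀ k, 0 < a k → lv k ≤ D + 1)
    (s₀ : κ) (x : ℝ) (hx0 : 0 < x) (hxq : x = ∏ i ∈ Finset.range (D + 1), q i)
    (htied : ∀ k, 0 < a k → k ≠ s₀ → (∏ i ∈ Finset.range (lv k), q i) * g k = x)
    (hheavy : x ≤ (∏ i ∈ Finset.range (lv s₀), q i) * g s₀)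
    (hbudget : (2 * j : ℝ) < ∑ k, (a k : ℝ) * ((∏ i ∈ Finset.range (lv k), q i) * g k)) :
    x ≤ TAIL[D + 1, q, lv, a, g, j] :=
  tail_ge_of_tied_plus_one_aux _ D q hq lv a g hg j hlv s₀ x hx0 hxq htied hheavy hbudget le_rfl

/-- **COROLLARY (the root-block form).**  The designated block at the root (`lv s₀ = 0`, gate `g s₀ ≥ x`): every block-comb that is all-tied
except ONE ROOT BLOCK satisfies the far-relay row. [this work] -/
theorem tail_ge_of_tied_plus_root (D : ℕ) (q : ℕ → ℝ) (hq : ∀ i, 0 ≤ q i ∧ q i ≤ 1) (lv : κ → ℕ) (a : κ → ℕ)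
    (g : κ → ℝ) (hg : ∀ k, 0 ≤ g k ∧ g k ≤ 1) (j : ℕ) (hlv : ∀ k, 0 < a k → lv k ≤ D + 1)
    (s₀ : κ) (hs₀ : lv s₀ = 0) (x : ℝ) (hx0 : 0 < x) (hxq : x = ∏ i ∈ Finset.range (D + 1), q i)
    (htied : ∀ k, 0 < a k → k ≠ s₀ → (∏ i ∈ Finset.range (lv k), q i) * g k = x) (hheavy : x ≤ g s₀)
    (hbudget : (2 * j : ℝ) < ∑ k, (a k : ℝ) * ((∏ i ∈ Finset.range (lv k), q i) * g k)) :
    x ≤ TAIL[D + 1, q, lv, a, g, j] :=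
  tail_ge_of_tied_plus_one D q hq lv a g hg j hlv s₀ x hx0 hxq htied
    (by rw [hs₀, Finset.prod_range_zero, one_mul]; exact hheavy) hbudget

end BlockComb

end Quant

end Summit.CriticalPhenomena.PercolationContinuityZ3.Theorems
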